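import Mathlib
import HarnessLib
import Literature.NumberTheory.DiophantineGeometry.BelyiPairDepth

/-!
# The descent step: from a deep Gauss point into a class that is not a pole

(Layer 3b of the bad-prime floor for the Belyi degree; continues `BelyiPairDepth`.)  For a tame
Belyi pair `(p, q)` over an algebraically closed field with valuation subring `A`:

* translation to an integral centre (`count_redRoots_eq_rootsInOpen_one`,
  `gaussValAt_one_eq_gaussVal`), density of the value group (`exists_between_of_lt`), reductions of
  rescaled polynomials whose roots sit strictly inside (`redPoly_comp_eq_X_pow`);
* `IsBelyiPair.edge_invariant` — along the edge from the Gauss point down to the cluster disc of a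
  residue class, the number of roots of `p - aₛ q` in the closed disc stays above the number of
  poles and the dominant Taylor coefficient stays bounded (induction over the breakpoints, using
  the all-shallow contradiction at each breakpoint and the optimal-centre non-constancy between);
* `IsBelyiPair.descend` — **the descent step**: from a deep pair and a class with special points
  that is not a pole of the reduction, the rescaled pair on the cluster disc of that class is deep
  and has `∞` as a pole of its reduction.

Folklore (non-archimedean geometry of tame covers `ℙ¹ → ℙ¹`; cf. U. Zannier, *Good reduction of
certain covers `ℙ¹ → ℙ¹`*, Israel J. Math. 124 (2001)); everything proved, no named facts.
-/

noncomputable section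

namespace Literature.NumberTheory.DiophantineGeometry

open Polynomial IsLocalRing Literature.RingTheory.Valuation
open scoped Classical

/-! ### Translation to an integral centre and the value group -/

section Centre

variable {K : Type*} [Field K] [IsAlgClosed K] (A : ValuationSubring K)

omit [IsAlgClosed K] in
/-- For `s₀ ∈ A`: `x ∈ A ↔ v(x - s₀) ≤ 1`. [folklore] -/
theorem mem_iff_valuation_sub_le_one {s₀ : K} (hs₀ : s₀ ∈ A) (x : K) :
    x ∈ A ↔ A.valuation (x - s₀) ≤ 1 := by
  rw [A.valuation_le_one_iff]
  constructor
  · intro hx; exact A.toSubring.sub_mem hx hs₀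
  · intro h; have : x = (x - s₀) + s₀ := by ring
    rw [this]; exact A.add_mem _ _ h hs₀

omit [IsAlgClosed K] in
/-- The number of integral roots is the number of roots in the closed unit disc around any
integral centre. [folklore] -/
theorem card_intRoots_eq_rootsIn_one (f : K[X]) {s₀ : K} (hs₀ : s₀ ∈ A) :
    Multiset.card (intRoots A f) = rootsIn A f s₀ 1 := by
  rw [card_intRoots, rootsIn]
  congr 1
  exact Multiset.filter_congr fun x _ => mem_iff_valuation_sub_le_one A hs₀ x

omit [IsAlgClosed K] in
/-- The number of integral roots with a given residue is the number of roots in the open unit disc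
around any integral centre with that residue. [folklore] -/
theorem count_redRoots_eq_rootsInOpen_one (f : K[X]) {s₀ : K} (hs₀ : s₀ ∈ A) :
    (redRoots A f).count (residue A ⟨s₀, hs₀⟩) = rootsInOpen A f s₀ 1 := by
  rw [count_redRoots, rootsInOpen, ← Multiset.card_map Subtype.val]
  have hmap : ((intRoots A f).filter fun b => residue A b = residue A ⟨s₀, hs₀⟩).map Subtype.val =
      ((intRoots A f).map Subtype.val).filter fun α => A.valuation (α - s₀) < 1 := by
    rw [Multiset.filter_map]
    congr 1
    refine Multiset.filter_congr fun b _ => ?_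
    simp only [Function.comp_apply]
    constructor
    · intro h; exact valuation_sub_lt_one_of_residue_eq A b.2 hs₀ (by simpa using h)
    · intro h
      obtain ⟨_, h'⟩ := mem_and_residue_eq_of_valuation_sub_lt_one A hs₀ h
      simpa using h'
  rw [hmap, map_val_intRoots, Multiset.filter_filter]
  congr 1
  refine Multiset.filter_congr fun α _ => ⟨fun h => h.1, fun h => ⟨h, ?_⟩⟩
  exact (mem_iff_valuation_sub_le_one A hs₀ α).mpr h.le

omit [IsAlgClosed K] in
/-- Translating by an integral element does not increase the Gauss value. [folklore] -/
theorem gaussVal_taylor_le [Nontrivial (ResidueField A)] (f : K[X]) {s₀ : K} (hs₀ : s₀ ∈ A)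
    (hs : f.Splits) : gaussVal A (taylor s₀ f) ≤ gaussVal A f := by
  by_cases hf : f = 0
  · rw [hf, map_zero]
  obtain ⟨c, hc, g, hgf, hgr⟩ := exists_model A hf hs
  have h1 := valuation_mul_gaussVal_eq_one hgf hgr
  have hvc : 0 < A.valuation c := zero_lt_iff.mpr ((Valuation.ne_zero_iff _).mpr hc)
  have hmap : (taylor (⟨s₀, hs₀⟩ : A) g).map (algebraMap A K) = C c * taylor s₀ f := by
    rw [taylor_apply, Polynomial.map_comp, hgf, Polynomial.map_add, map_X, map_C,
      ValuationSubring.algebraMap_apply, taylor_apply, mul_comp, C_comp]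
  have hle := gaussVal_map_le_one A (taylor (⟨s₀, hs₀⟩ : A) g)
  rw [hmap, gaussVal_C_mul, ← h1] at hle
  exact (mul_le_mul_iff_of_pos_left hvc).mp hle

/-- **The Gauss value is translation invariant** (integral translations): the Gauss value on the
unit disc around `s₀ ∈ A` is the Gauss value. [folklore] -/
theorem gaussValAt_one_eq_gaussVal (f : K[X]) {s₀ : K} (hs₀ : s₀ ∈ A) :
    gaussValAt A f s₀ 1 = gaussVal A f := by
  have h1 : gaussValAt A f s₀ 1 = gaussVal A (taylor s₀ f) := by
    rw [← (A.valuation).map_one, ← gaussVal_comp, C_1, one_mul, add_comm, ← taylor_apply]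
  rw [h1]
  apply le_antisymm (gaussVal_taylor_le A f hs₀ (IsAlgClosed.splits f))
  have h2 : f = taylor (-s₀) (taylor s₀ f) := by
    rw [taylor_taylor, neg_add_cancel, taylor_zero]
  conv_lhs => rw [h2]
  exact gaussVal_taylor_le A _ (A.neg_mem _ hs₀) (IsAlgClosed.splits _)

omit [IsAlgClosed K] in
/-- The formula centre of a rescaled pair only depends on the Taylor coefficients at the centre in
the dominant degree. [folklore] -/
theorem centre_comp (p q : K[X]) (s₀ : K) {c : K} (hc : c ≠ 0) :
    centre A (p.comp (C s₀ + C c * X)) (q.comp (C s₀ + C c * X)) =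
      (taylor s₀ p).coeff (rootsIn A q s₀ (A.valuation c)) /
        (taylor s₀ q).coeff (rootsIn A q s₀ (A.valuation c)) := by
  unfold centre
  rw [card_intRoots_comp_eq_rootsIn q s₀ hc, coeff_comp_C_add_C_mul_X, coeff_comp_C_add_C_mul_X,
    mul_div_mul_right _ _ (pow_ne_zero _ hc)]

omit [IsAlgClosed K] in
/-- Rescaling a difference `p - a q`. [folklore] -/
theorem sub_C_mul_comp (p q : K[X]) (a : K) (L : K[X]) :
    (p - C a * q).comp L = p.comp L - C a * q.comp L := by
  rw [sub_comp, mul_comp, C_comp]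

/-- **Square roots in the value group** of an algebraically closed field. [folklore] -/
theorem exists_mul_self_eq (γ : A.ValueGroup) : ∃ ε : A.ValueGroup, ε * ε = γ := by
  obtain ⟨x, rfl⟩ := A.valuation_surjective γ
  obtain ⟨y, hy⟩ := IsAlgClosed.exists_pow_nat_eq x (by norm_num : 0 < 2)
  exact ⟨A.valuation y, by rw [← map_mul, ← pow_two, hy]⟩

/-- **The value group is densely ordered above `0`**: between two non-zero values there is a
third. [folklore] -/
theorem exists_between_of_lt {γ₁ γ₂ : A.ValueGroup} (h0 : γ₁ ≠ 0) (h : γ₁ < γ₂) :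
    ∃ γ : A.ValueGroup, γ₁ < γ ∧ γ < γ₂ := by
  obtain ⟨ε₁, hε₁⟩ := exists_mul_self_eq A γ₁
  obtain ⟨ε₂, hε₂⟩ := exists_mul_self_eq A γ₂
  have hε₁0 : ε₁ ≠ 0 := fun h' => h0 (by rw [← hε₁, h', zero_mul])
  have hε₁pos : 0 < ε₁ := zero_lt_iff.mpr hε₁0
  have hlt : ε₁ < ε₂ := by
    by_contra hle
    rw [not_lt] at hle
    have : γ₂ ≤ γ₁ := by
      rw [← hε₁, ← hε₂]; exact mul_le_mul' hle hle
    exact (not_le.mpr h) this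
  have hε₂pos : 0 < ε₂ := lt_trans hε₁pos hlt
  refine ⟨ε₁ * ε₂, ?_, ?_⟩
  · rw [← hε₁]; exact mul_lt_mul_of_pos_left hlt hε₁pos
  · rw [← hε₂]; exact mul_lt_mul_of_pos_right hlt hε₂pos

end Centre

/-! ### Reductions of rescaled polynomials whose roots sit strictly inside -/

section Rescaled

variable {K : Type*} [Field K] [IsAlgClosed K] (A : ValuationSubring K)

omit [IsAlgClosed K] in
/-- If every root of `f` in the closed disc `D(s₀, v c)` lies in the OPEN disc, the reduction of the
rescaled polynomial `f(s₀ + cX)` is a power of `X`. [folklore] -/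
theorem redPoly_comp_eq_X_pow (f : K[X]) (s₀ : K) {c : K} (hc : c ≠ 0)
    (h : ∀ α ∈ f.roots, A.valuation (α - s₀) ≤ A.valuation c → A.valuation (α - s₀) < A.valuation c) :
    redPoly A (f.comp (C s₀ + C c * X)) = X ^ rootsIn A f s₀ (A.valuation c) := by
  have hvc : A.valuation c ≠ 0 := (Valuation.ne_zero_iff _).mpr hc
  have hall : ∀ b ∈ intRoots A (f.comp (C s₀ + C c * X)), residue A b = 0 := by
    intro b hb
    rw [mem_intRoots, roots_comp_C_add_C_mul_X f s₀ hc] at hb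
    obtain ⟨α, hα, hαb⟩ := Multiset.mem_map.mp hb
    have hle : A.valuation (α - s₀) ≤ A.valuation c := by
      have : A.valuation (b : K) ≤ 1 := (A.valuation_le_one_iff _).mpr b.2
      rw [← hαb, map_mul, map_inv₀, inv_mul_le_iff₀ (zero_lt_iff.mpr hvc), mul_one] at this
      exact this
    have hlt := h α hα hle
    rw [residue_eq_zero_iff, A.valuation_lt_one_iff]
    show A.valuation (b : K) < 1
    rw [← hαb, map_mul, map_inv₀, inv_mul_lt_iff₀ (zero_lt_iff.mpr hvc), mul_one]
    exact hlt
  have hred : redRoots A (f.comp (C s₀ + C c * X)) =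
      Multiset.replicate (rootsIn A f s₀ (A.valuation c)) 0 := by
    rw [← card_intRoots_comp_eq_rootsIn f s₀ hc, redRoots, Multiset.eq_replicate]
    refine ⟨Multiset.card_map _ _, fun x hx => ?_⟩
    obtain ⟨b, hb, rfl⟩ := Multiset.mem_map.mp hx
    exact hall b hb
  rw [redPoly, hred, Multiset.map_replicate, Multiset.prod_replicate, C_0, sub_zero]

omit [IsAlgClosed K] in
/-- Under the same hypothesis, no integral root of `f(s₀ + cX)` has a non-zero residue. [folklore] -/
theorem count_redRoots_comp_eq_zero (f : K[X]) (s₀ : K) {c : K} (hc : c ≠ 0)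
    (h : ∀ α ∈ f.roots, A.valuation (α - s₀) ≤ A.valuation c → A.valuation (α - s₀) < A.valuation c)
    {w : ResidueField A} (hw : w ≠ 0) : (redRoots A (f.comp (C s₀ + C c * X))).count w = 0 := by
  rw [← rootMultiplicity_redPoly, redPoly_comp_eq_X_pow A f s₀ hc h, rootMultiplicity_eq_zero_iff]
  intro hroot
  exfalso
  rw [IsRoot.def, eval_pow, eval_X] at hroot
  by_cases hn : rootsIn A f s₀ (A.valuation c) = 0
  · rw [hn, pow_zero] at hroot; exact one_ne_zero hroot
  · exact hw ((pow_eq_zero_iff hn).mp hroot)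

omit [IsAlgClosed K] in
/-- `ord₀` of the reduction of the rescaled polynomial counts the roots in the open disc.
[folklore] -/
theorem rootMultiplicity_zero_redPoly_comp (f : K[X]) (s₀ : K) {c : K} (hc : c ≠ 0) :
    (redPoly A (f.comp (C s₀ + C c * X))).rootMultiplicity 0 = rootsInOpen A f s₀ (A.valuation c) := by
  rw [rootMultiplicity_redPoly, count_redRoots_comp_zero f s₀ hc]

end Rescaled

/-! ### The edge invariant -/

section Edge

variable {K : Type*} [Field K] [IsAlgClosed K] [CharZero K] (A : ValuationSubring K)
variable {d : ℕ} {p q : K[X]}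

/-- **The edge invariant (downward).**  Let `(p, q)` be a tame Belyi pair, `s₀ ∈ A`, and suppose
all special points at distance `< 1` from `s₀` are at distance `≤ γ₁ < 1`; let `μ > 0` be the number
of poles in that open unit disc, `a_s = p^{(μ)}(s₀)/q^{(μ)}(s₀)` the common formula centre of all
discs `D(s₀, γ)`, `γ₁ ≤ γ < 1`, and `P' = p - a_s q`.  If the open unit disc contains
`m ≥ μ + 1` roots of `P'` and the Taylor coefficient `P'_m` is bounded by `θ · v(q_μ)` with
`θ < r_Y(a_s)`, then for EVERY radius `γ = v(c) ∈ [γ₁, 1)`: the closed disc `D(s₀, γ)` contains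
`≥ μ + 1` roots of `P'`, and the corresponding Taylor coefficient is still bounded by `θ · v(q_μ)`.
(Induction over the breakpoints from the top: at each breakpoint the point is deep, the all-shallow
contradiction forbids a sign change of `#roots(P') - μ`, and the optimal-centre non-constancy
forbids equality in between.) [folklore] -/
theorem IsBelyiPair.edge_invariant (h : IsBelyiPair d p q)
    (htame : ∀ n : ℕ, 0 < n → n ≤ d → (n : ResidueField A) ≠ 0) {s₀ : K}
    {γ₁ : A.ValueGroup}
    (hspec : ∀ s ∈ (p * q * (p - q)).roots, A.valuation (s - s₀) < 1 → A.valuation (s - s₀) ≤ γ₁)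
    {μ : ℕ} (hμ : μ = rootsInOpen A q s₀ 1) (hμ0 : 0 < μ)
    {aₛ : K} (haₛ : aₛ = (taylor s₀ p).coeff μ / (taylor s₀ q).coeff μ)
    {m : ℕ} (hm : m = rootsInOpen A (p - C aₛ * q) s₀ 1) (hμm : μ + 1 ≤ m)
    {θ : A.ValueGroup}
    (hθ : A.valuation ((taylor s₀ (p - C aₛ * q)).coeff m) ≤ θ * A.valuation ((taylor s₀ q).coeff μ))
    (hθY : θ < rY A aₛ) {c : K} (hc : c ≠ 0) (hcγ₁ : γ₁ ≤ A.valuation c) (hc1 : A.valuation c < 1) :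
    μ + 1 ≤ rootsIn A (p - C aₛ * q) s₀ (A.valuation c) ∧
      A.valuation ((taylor s₀ (p - C aₛ * q)).coeff (rootsIn A (p - C aₛ * q) s₀ (A.valuation c))) ≤
        θ * A.valuation ((taylor s₀ q).coeff μ) := by
  set P' := p - C aₛ * q with hP'
  have hP'0 : P' ≠ 0 := h.sub_C_mul_ne_zero aₛ
  have hq0 : q ≠ 0 := h.right_ne_zero
  -- poles: every radius in `[γ₁, 1)` sees exactly `μ` poles
  have hpoles : ∀ β ∈ q.roots, A.valuation (β - s₀) < 1 → A.valuation (β - s₀) ≤ γ₁ := by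
    intro β hβ
    refine hspec β ?_
    rw [h.roots_prod]
    exact Multiset.mem_add.mpr (Or.inl (Multiset.mem_add.mpr (Or.inr hβ)))
  have hrq : ∀ {e : K}, e ≠ 0 → γ₁ ≤ A.valuation e → A.valuation e < 1 →
      rootsIn A q s₀ (A.valuation e) = μ := by
    intro e he heγ he1
    rw [hμ, rootsIn, rootsInOpen]
    congr 1
    refine Multiset.filter_congr fun β hβ => ⟨fun hle => lt_of_le_of_lt hle he1, fun hlt => ?_⟩
    exact (hpoles β hβ hlt).trans heγ
  have hrqo : ∀ {e : K}, e ≠ 0 → γ₁ < A.valuation e → A.valuation e < 1 →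
      rootsInOpen A q s₀ (A.valuation e) = μ := by
    intro e he heγ he1
    rw [hμ, rootsInOpen, rootsInOpen]
    congr 1
    refine Multiset.filter_congr fun β hβ => ⟨fun hle => lt_trans hle he1, fun hlt => ?_⟩
    exact lt_of_le_of_lt (hpoles β hβ hlt) heγ
  -- the Taylor coefficient `q_μ` computes the Gauss value of `q` on every such disc
  have hQμ : ∀ {e : K}, e ≠ 0 → γ₁ ≤ A.valuation e → A.valuation e < 1 →
      A.valuation ((taylor s₀ q).coeff μ) * A.valuation e ^ μ = gaussValAt A q s₀ (A.valuation e) := by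
    intro e he heγ he1
    have := valuation_taylor_coeff_rootsIn (A := A) hq0 (IsAlgClosed.splits q) s₀ he
    rwa [hrq he heγ he1] at this
  have hQμ0 : A.valuation ((taylor s₀ q).coeff μ) ≠ 0 := by
    intro h0
    have := hQμ hc hcγ₁ hc1
    rw [h0, zero_mul, ← gaussVal_comp] at this
    exact gaussVal_ne_zero A (comp_C_add_C_mul_X_ne_zero hq0 s₀ hc) this.symm
  -- centres of the rescaled pairs
  have hcentre : ∀ {e : K}, e ≠ 0 → γ₁ ≤ A.valuation e → A.valuation e < 1 →
      centre A (p.comp (C s₀ + C e * X)) (q.comp (C s₀ + C e * X)) = aₛ := by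
    intro e he heγ he1
    rw [centre_comp A p q s₀ he, hrq he heγ he1, haₛ]
  -- strong induction on the number of roots of `P'` strictly between the radius and `1`
  suffices key : ∀ (N : ℕ) (e : K), e ≠ 0 → γ₁ ≤ A.valuation e → A.valuation e < 1 →
      m - rootsIn A P' s₀ (A.valuation e) = N →
      μ + 1 ≤ rootsIn A P' s₀ (A.valuation e) ∧
        A.valuation ((taylor s₀ P').coeff (rootsIn A P' s₀ (A.valuation e))) ≤
          θ * A.valuation ((taylor s₀ q).coeff μ) from key _ c hc hcγ₁ hc1 rfl
  intro N
  induction N using Nat.strong_induction_on with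
  | _ N ih =>
  intro e he heγ he1 hN
  -- roots of `P'` in the closed disc never exceed those in the open unit disc
  have hle_m : rootsIn A P' s₀ (A.valuation e) ≤ m := by
    rw [hm, rootsIn, rootsInOpen]
    exact Multiset.card_le_card (Multiset.monotone_filter_right _ fun β hβ => lt_of_le_of_lt hβ he1)
  by_cases hN0 : N = 0
  · -- no root of `P'` between: the closed disc already contains all `m` of them
    have hEq : rootsIn A P' s₀ (A.valuation e) = m := by omega
    rw [hEq]
    exact ⟨hμm, hθ⟩
  · -- the next breakpoint `β` above `v e`
    have hexists : ∃ τ ∈ P'.roots, A.valuation e < A.valuation (τ - s₀) ∧ A.valuation (τ - s₀) < 1 := by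
      by_contra hnone
      push Not at hnone
      have : rootsIn A P' s₀ (A.valuation e) = m := by
        rw [hm, rootsIn, rootsInOpen]
        congr 1
        refine Multiset.filter_congr fun τ hτ => ⟨fun hle => lt_of_le_of_lt hle he1, fun hlt => ?_⟩
        by_contra hgt
        exact absurd (hnone τ hτ (not_le.mp hgt)) (not_le.mpr hlt)
      omega
    -- `β` := the least such distance, realised by a root `τ₀`
    obtain ⟨τ₀, hτ₀, hτ₀min⟩ := Finset.exists_min_image
      ((P'.roots.toFinset).filter fun τ => A.valuation e < A.valuation (τ - s₀) ∧ A.valuation (τ - s₀) < 1)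
      (fun τ => A.valuation (τ - s₀))
      (by obtain ⟨τ, hτ, h1, h2⟩ := hexists
          exact ⟨τ, Finset.mem_filter.mpr ⟨Multiset.mem_toFinset.mpr hτ, h1, h2⟩⟩)
    rw [Finset.mem_filter, Multiset.mem_toFinset] at hτ₀
    obtain ⟨hτ₀r, heβ, hβ1⟩ := hτ₀
    set cβ : K := τ₀ - s₀ with hcβ
    have hcβ0 : cβ ≠ 0 := by
      intro h0; rw [h0, map_zero] at heβ; exact (not_lt.mpr zero_le) heβ
    have hγβ : γ₁ < A.valuation cβ := lt_of_le_of_lt heγ heβ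
    have hmin : ∀ τ ∈ P'.roots, A.valuation e < A.valuation (τ - s₀) → A.valuation (τ - s₀) < 1 →
        A.valuation cβ ≤ A.valuation (τ - s₀) := fun τ hτ h1 h2 =>
      hτ₀min τ (Finset.mem_filter.mpr ⟨Multiset.mem_toFinset.mpr hτ, h1, h2⟩)
    -- counts at `β`: closed `n`, open `n'`, and `n' = rootsIn (v e)`
    set n := rootsIn A P' s₀ (A.valuation cβ) with hn
    set n' := rootsInOpen A P' s₀ (A.valuation cβ) with hn'
    have hn'e : n' = rootsIn A P' s₀ (A.valuation e) := by
      rw [hn', rootsIn, rootsInOpen]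
      congr 1
      refine Multiset.filter_congr fun τ hτ => ⟨fun hlt => ?_, fun hle => lt_of_le_of_lt hle heβ⟩
      by_contra hgt
      exact absurd (hmin τ hτ (not_le.mp hgt) (lt_trans hlt hβ1)) (not_le.mpr hlt)
    have hn'lt : n' < n := by
      -- `τ₀` itself is counted in `n` but not in `n'`
      rw [hn, hn', rootsIn, rootsInOpen]
      apply Multiset.card_lt_card
      refine lt_of_le_of_ne (Multiset.monotone_filter_right _ fun τ hτ => hτ.le) fun heq => ?_
      have hmem : τ₀ ∈ P'.roots.filter fun α => A.valuation (α - s₀) ≤ A.valuation cβ :=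
        Multiset.mem_filter.mpr ⟨hτ₀r, le_rfl⟩
      rw [← heq, Multiset.mem_filter] at hmem
      exact lt_irrefl _ hmem.2
    have hn_le_m : n ≤ m := by
      rw [hn, hm, rootsIn, rootsInOpen]
      exact Multiset.card_le_card (Multiset.monotone_filter_right _ fun β hβ => lt_of_le_of_lt hβ hβ1)
    -- induction hypothesis at `β`
    have hIH := ih (m - n) (by omega) cβ hcβ0 hγβ.le hβ1 rfl
    rw [← hn] at hIH
    obtain ⟨hnμ, hθn⟩ := hIH
    -- Gauss values at `β`: both indices `n` (closed) and `n'` (open) are dominant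
    have hGn : A.valuation ((taylor s₀ P').coeff n) * A.valuation cβ ^ n =
        gaussValAt A P' s₀ (A.valuation cβ) := by
      rw [hn]; exact valuation_taylor_coeff_rootsIn hP'0 (IsAlgClosed.splits _) s₀ hcβ0
    have hGn' : A.valuation ((taylor s₀ P').coeff n') * A.valuation cβ ^ n' =
        gaussValAt A P' s₀ (A.valuation cβ) := by
      rw [hn']; exact valuation_taylor_coeff_rootsInOpen hP'0 (IsAlgClosed.splits _) s₀ hcβ0
    have hvβ : 0 < A.valuation cβ := zero_lt_iff.mpr ((Valuation.ne_zero_iff _).mpr hcβ0)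
    have hvβ1 : A.valuation cβ ≤ 1 := hβ1.le
    -- the coefficient bound propagates: `v(P'_{n'}) = v(P'_n) β^(n - n') ≤ v(P'_n)`
    have hcoeff' : A.valuation ((taylor s₀ P').coeff n') ≤ θ * A.valuation ((taylor s₀ q).coeff μ) := by
      have e1 : A.valuation ((taylor s₀ P').coeff n') * A.valuation cβ ^ n' =
          A.valuation ((taylor s₀ P').coeff n) * A.valuation cβ ^ (n - n') * A.valuation cβ ^ n' := by
        rw [hGn', ← hGn, mul_assoc, ← pow_add, Nat.sub_add_cancel hn'lt.le]
      have e2 : A.valuation ((taylor s₀ P').coeff n') =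
          A.valuation ((taylor s₀ P').coeff n) * A.valuation cβ ^ (n - n') :=
        mul_right_cancel₀ (pow_ne_zero n' hvβ.ne') e1
      rw [e2]
      exact (mul_le_of_le_one_right' (pow_le_one₀ zero_le hvβ1)).trans hθn
    -- the rescaled pair at `β` is deep (for the centre `aₛ`)
    have hpairβ := h.comp s₀ hcβ0
    set Lβ : K[X] := C s₀ + C cβ * X with hLβ
    have hPLβ : P'.comp Lβ = p.comp Lβ - C aₛ * q.comp Lβ := sub_C_mul_comp p q aₛ Lβ
    have hdeepβ : IsDeepPair A (p.comp Lβ) (q.comp Lβ) := by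
      refine ⟨aₛ, ?_⟩
      rw [← hPLβ, hLβ, gaussVal_comp, gaussVal_comp, ← hGn, ← hQμ hcβ0 hγβ.le hβ1]
      -- `v(P'_n) β^n ≤ θ v(q_μ) β^n ≤ θ v(q_μ) β^μ < rY · v(q_μ) β^μ`
      have hle1 : A.valuation cβ ^ n ≤ A.valuation cβ ^ μ :=
        pow_le_pow_right_of_le_one' hvβ1 (by omega)
      have hpos : 0 < A.valuation ((taylor s₀ q).coeff μ) * A.valuation cβ ^ μ :=
        mul_pos (zero_lt_iff.mpr hQμ0) (pow_pos hvβ μ)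
      calc A.valuation ((taylor s₀ P').coeff n) * A.valuation cβ ^ n
          ≤ θ * A.valuation ((taylor s₀ q).coeff μ) * A.valuation cβ ^ n := mul_le_mul' hθn le_rfl
        _ ≤ θ * A.valuation ((taylor s₀ q).coeff μ) * A.valuation cβ ^ μ := mul_le_mul' le_rfl hle1
        _ = θ * (A.valuation ((taylor s₀ q).coeff μ) * A.valuation cβ ^ μ) := by rw [mul_assoc]
        _ < rY A aₛ * (A.valuation ((taylor s₀ q).coeff μ) * A.valuation cβ ^ μ) :=
            mul_lt_mul_of_pos_right hθY hpos
    -- the all-shallow contradiction at `β` forbids `n' < μ < n`; we have `μ < n`, so `μ ≤ n'`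
    have hn'μ : μ ≤ n' := by
      by_contra hlt
      rw [not_le] at hlt
      refine hpairβ.false_of_forall_shallow A htame hdeepβ (v₀ := 0) ?_ ?_ ?_
      · rw [hLβ, count_redRoots_comp_zero q s₀ hcβ0, hrqo hcβ0 hγβ hβ1]; exact hμ0
      · intro w hw
        by_cases hw0 : w = 0
        · subst hw0
          rw [hcentre hcβ0 hγβ.le hβ1, ← hPLβ, hLβ, rootMultiplicity_zero_redPoly_comp A _ _ hcβ0,
            rootMultiplicity_zero_redPoly_comp A _ _ hcβ0, hrqo hcβ0 hγβ hβ1]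
          exact hlt
        · exfalso
          rw [hLβ, count_redRoots_comp_eq_zero A q s₀ hcβ0 ?_ hw0] at hw
          · exact lt_irrefl 0 hw
          · intro α hα hle
            by_cases h1 : A.valuation (α - s₀) < 1
            · exact lt_of_le_of_lt (hpoles α hα h1) hγβ
            · exact absurd (lt_of_le_of_lt hle hβ1) h1
      · rw [hcentre hcβ0 hγβ.le hβ1, ← hPLβ, hLβ, card_intRoots_comp_eq_rootsIn q s₀ hcβ0,
          card_intRoots_comp_eq_rootsIn P' s₀ hcβ0, hrq hcβ0 hγβ.le hβ1]
        exact hnμ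
    -- non-constancy at a radius strictly between `v e` and `β` forbids `n' = μ`
    have hn'ne : n' ≠ μ := by
      intro heq
      have hve0 : A.valuation e ≠ 0 := (Valuation.ne_zero_iff _).mpr he
      obtain ⟨γ, heγ', hγβ'⟩ := exists_between_of_lt A hve0 heβ
      obtain ⟨e', he'⟩ := A.valuation_surjective γ
      rw [← he'] at heγ' hγβ'
      have he'0 : e' ≠ 0 := by
        intro h0; rw [h0, map_zero] at heγ'; exact (not_lt.mpr zero_le) heγ'
      have hγ₁e' : γ₁ < A.valuation e' := lt_of_le_of_lt heγ heγ'
      have he'1 : A.valuation e' < 1 := lt_trans hγβ' hβ1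
      -- at `v e'` the closed count is `n'`
      have hcount : rootsIn A P' s₀ (A.valuation e') = n' := by
        rw [hn'e, rootsIn, rootsIn]
        congr 1
        refine Multiset.filter_congr fun τ hτ => ⟨fun hle => ?_, fun hle => hle.trans heγ'.le⟩
        by_contra hgt
        rw [not_le] at hgt
        exact absurd (hmin τ hτ hgt (lt_of_le_of_lt hle he'1)) (not_le.mpr (lt_of_le_of_lt hle hγβ'))
      -- the reductions are `X^n'` and `X^μ`: constant ratio, contradiction
      have hpair' := h.comp s₀ he'0
      have hopt := (hpair'.optimal_centre A rfl rfl).2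
      rw [← centre, hcentre he'0 hγ₁e'.le he'1, ← sub_C_mul_comp, redPoly_comp_eq_X_pow A P' s₀ he'0,
        redPoly_comp_eq_X_pow A q s₀ he'0, hcount, hrq he'0 hγ₁e'.le he'1, heq] at hopt
      · exact hopt rfl
      · intro α hα hle
        by_cases h1 : A.valuation (α - s₀) < 1
        · exact lt_of_le_of_lt (hpoles α hα h1) hγ₁e'
        · exact absurd (lt_of_le_of_lt hle he'1) h1
      · intro τ hτ hle
        refine lt_of_le_of_ne hle fun heq' => ?_
        have h1 : A.valuation e < A.valuation (τ - s₀) := by rw [heq']; exact heγ'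
        have h2 : A.valuation (τ - s₀) < 1 := by rw [heq']; exact he'1
        exact absurd (hmin τ hτ h1 h2) (by rw [heq']; exact not_le.mpr hγβ')
    rw [← hn'e]
    exact ⟨by omega, hcoeff'⟩

end Edge

/-! ### The descent step -/

section Descend

variable {K : Type*} [Field K] [IsAlgClosed K] [CharZero K] (A : ValuationSubring K)
variable {d : ℕ} {p q : K[X]}

/-- **The descent step.**  Let `(p, q)` be a tame deep Belyi pair and `v` a residue class with
special points which is NOT a pole of the reduction `redPoly (p - a q)/redPoly q` (`a` the formula
centre).  Let `s₀` be a pole in the class and `c₁ = s₁ - s₀` point to a farthest special point of the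
class.  Then the rescaled pair on the cluster disc `D(s₀, v c₁)` is again deep, and for it the point
`∞` IS a pole of the reduction (`#intRoots q' < #intRoots (p' - a' q')` for its own formula centre
`a'`). [folklore] -/
theorem IsBelyiPair.descend (h : IsBelyiPair d p q)
    (htame : ∀ n : ℕ, 0 < n → n ≤ d → (n : ResidueField A) ≠ 0) (hdeep : IsDeepPair A p q)
    {v : ResidueField A} (hv0 : 0 < (redRoots A q).count v)
    (hv : (redPoly A q).rootMultiplicity v ≤ (redPoly A (p - C (centre A p q) * q)).rootMultiplicity v) :
    ∃ s₀ c₁ : K, s₀ ∈ (p * q * (p - q)).roots ∧ (∃ hs₀ : s₀ ∈ A, residue A ⟨s₀, hs₀⟩ = v) ∧ c₁ ≠ 0 ∧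
      A.valuation c₁ < 1 ∧ s₀ + c₁ ∈ (p * q * (p - q)).roots ∧
      (∀ s ∈ (p * q * (p - q)).roots, A.valuation (s - s₀) < 1 → A.valuation (s - s₀) ≤ A.valuation c₁) ∧
      IsDeepPair A (p.comp (C s₀ + C c₁ * X)) (q.comp (C s₀ + C c₁ * X)) ∧
      Multiset.card (intRoots A (q.comp (C s₀ + C c₁ * X))) <
        Multiset.card (intRoots A (p.comp (C s₀ + C c₁ * X) -
          C (centre A (p.comp (C s₀ + C c₁ * X)) (q.comp (C s₀ + C c₁ * X))) * q.comp (C s₀ + C c₁ * X))) := by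
  have hq0 : q ≠ 0 := h.right_ne_zero
  have hp0 : p ≠ 0 := h.left_ne_zero
  have hF0 := h.prod_ne_zero
  set a := centre A p q with ha
  -- the chart and the depth bound `v b < r_Y(a)`
  obtain ⟨b, c', gP, gQ, u, hb0, hc', hu, hbq, hgPf, hgPr, hgQf, hgQr⟩ := h.exists_chart A
  have hgq : 0 < gaussVal A q := zero_lt_iff.mpr (gaussVal_ne_zero A hq0)
  have hdeepa := h.gaussVal_sub_centre_lt A hdeep
  rw [← ha, ← hbq] at hdeepa
  have hbY : A.valuation b < rY A a := lt_of_mul_lt_mul_right' hdeepa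
  -- entering: `λ = a + b t` with more `λ`-points than poles in the class
  obtain ⟨t, ht⟩ := h.entering A hu hgPf hgPr hgQf hgQr hv
  set lam : K := a + b * t with hlam
  set Λ : K[X] := p - C lam * q with hΛ
  have hΛ0 : Λ ≠ 0 := h.sub_C_mul_ne_zero lam
  have hgΛ : gaussVal A Λ = A.valuation b * gaussVal A q := by
    rw [hΛ, hlam, h.gaussVal_shift A hc' hgPf hgPr hgQf hgQr t, hbq]
  have hlama : A.valuation (lam - a) ≤ A.valuation b := by
    rw [hlam, add_sub_cancel_left, map_mul]
    exact mul_le_of_le_one_right' (A.valuation_le_one t)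
  -- the pole `s₀` in the class
  obtain ⟨β₀, hβ₀, hβ₀v⟩ : ∃ β ∈ intRoots A q, residue A β = v := by
    have : v ∈ redRoots A q := Multiset.count_pos.mp hv0
    obtain ⟨β, hβ, hβv⟩ := Multiset.mem_map.mp this
    exact ⟨β, hβ, hβv⟩
  set s₀ : K := (β₀ : K) with hs₀
  have hs₀A : s₀ ∈ A := β₀.2
  have hs₀q : s₀ ∈ q.roots := (mem_intRoots A).mp hβ₀
  have hs₀F : s₀ ∈ (p * q * (p - q)).roots := by
    rw [h.roots_prod]; exact Multiset.mem_add.mpr (Or.inl (Multiset.mem_add.mpr (Or.inr hs₀q)))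
  have hres₀ : residue A ⟨s₀, hs₀A⟩ = v := by rw [← hβ₀v]
  -- counts in the class
  set μ := rootsInOpen A q s₀ 1 with hμ
  have hμv : (redRoots A q).count v = μ := by
    rw [← hres₀, count_redRoots_eq_rootsInOpen_one A q hs₀A]
  have hμ0 : 0 < μ := by rw [← hμv]; exact hv0
  set m := rootsInOpen A Λ s₀ 1 with hm
  have hmv : (redRoots A Λ).count v = m := by
    rw [← hres₀, count_redRoots_eq_rootsInOpen_one A Λ hs₀A]
  have hμm : μ + 1 ≤ m := by rw [← hμv, ← hmv]; exact ht
  -- a zero in the class, distinct from the pole `s₀`: the class has `≥ 2` special points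
  have hredp : redPoly A p = redPoly A q := IsDeepPair.redPoly_left_eq A hdeep
  obtain ⟨α₀, hα₀, hα₀v⟩ : ∃ α ∈ intRoots A p, residue A α = v := by
    have : 0 < (redRoots A p).count v := by
      rw [← roots_redPoly, hredp, roots_redPoly]; exact hv0
    obtain ⟨α, hα, hαv⟩ := Multiset.mem_map.mp (Multiset.count_pos.mp this)
    exact ⟨α, hα, hαv⟩
  have hα₀p : (α₀ : K) ∈ p.roots := (mem_intRoots A).mp hα₀
  have hα₀s₀ : (α₀ : K) ≠ s₀ := by
    intro heq
    have hps : p.IsRoot s₀ := by rw [← heq]; exact (mem_roots hp0).mp hα₀p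
    have := rootMultiplicity_eq_zero_of_isCoprime_of_isRoot h.isCoprime hps
    exact ((rootMultiplicity_pos hq0).mpr ((mem_roots hq0).mp hs₀q)).ne' this
  have hα₀F : (α₀ : K) ∈ (p * q * (p - q)).roots := by
    rw [h.roots_prod]; exact Multiset.mem_add.mpr (Or.inl (Multiset.mem_add.mpr (Or.inl hα₀p)))
  have hα₀lt : A.valuation ((α₀ : K) - s₀) < 1 :=
    valuation_sub_lt_one_of_residue_eq A α₀.2 hs₀A (by simpa using hα₀v.trans hres₀.symm)
  -- the farthest special point `s₁` of the class
  set Sv := ((p * q * (p - q)).roots.toFinset.filter fun s => A.valuation (s - s₀) < 1 ∧ s ≠ s₀)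
    with hSv
  have hSvne : Sv.Nonempty :=
    ⟨α₀, Finset.mem_filter.mpr ⟨Multiset.mem_toFinset.mpr hα₀F, hα₀lt, hα₀s₀⟩⟩
  obtain ⟨s₁, hs₁, hs₁max⟩ := Finset.exists_max_image Sv (fun s => A.valuation (s - s₀)) hSvne
  rw [Finset.mem_filter, Multiset.mem_toFinset] at hs₁
  obtain ⟨hs₁F, hs₁lt, hs₁ne⟩ := hs₁
  set c₁ : K := s₁ - s₀ with hc₁
  have hc₁0 : c₁ ≠ 0 := _root_.sub_ne_zero.mpr hs₁ne
  have hγ₁0 : 0 < A.valuation c₁ := zero_lt_iff.mpr ((Valuation.ne_zero_iff _).mpr hc₁0)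
  have hγ₁1 : A.valuation c₁ < 1 := hs₁lt
  have hspec : ∀ s ∈ (p * q * (p - q)).roots, A.valuation (s - s₀) < 1 →
      A.valuation (s - s₀) ≤ A.valuation c₁ := by
    intro s hs hslt
    by_cases hss : s = s₀
    · rw [hss, sub_self, map_zero]; exact zero_le
    · exact hs₁max s (Finset.mem_filter.mpr ⟨Multiset.mem_toFinset.mpr hs, hslt, hss⟩)
  have hpoles : ∀ β ∈ q.roots, A.valuation (β - s₀) < 1 → A.valuation (β - s₀) ≤ A.valuation c₁ := by
    intro β hβ
    refine hspec β ?_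
    rw [h.roots_prod]; exact Multiset.mem_add.mpr (Or.inl (Multiset.mem_add.mpr (Or.inr hβ)))
  -- pole counts on the edge
  have hrq : ∀ {e : K}, e ≠ 0 → A.valuation c₁ ≤ A.valuation e → A.valuation e < 1 →
      rootsIn A q s₀ (A.valuation e) = μ := by
    intro e he heγ he1
    rw [hμ, rootsIn, rootsInOpen]
    congr 1
    refine Multiset.filter_congr fun β hβ => ⟨fun hle => lt_of_le_of_lt hle he1, fun hlt => ?_⟩
    exact (hpoles β hβ hlt).trans heγ
  -- the edge centre `aₛ` and `P' = p - aₛ q`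
  set aₛ : K := (taylor s₀ p).coeff μ / (taylor s₀ q).coeff μ with haₛ
  set P' : K[X] := p - C aₛ * q with hP'
  have hP'0 : P' ≠ 0 := h.sub_C_mul_ne_zero aₛ
  -- Gauss values at radius `1`: `v(q_μ) = |q|`, `v(Λ_m) = |Λ| = v b |q|`
  have hQμ1 : A.valuation ((taylor s₀ q).coeff μ) = gaussVal A q := by
    have := valuation_taylor_coeff_rootsInOpen (A := A) hq0 (IsAlgClosed.splits q) s₀ one_ne_zero
    rw [map_one, one_pow, mul_one, gaussValAt_one_eq_gaussVal A q hs₀A] at this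
    rwa [hμ]
  have hΛm1 : A.valuation ((taylor s₀ Λ).coeff m) = A.valuation b * gaussVal A q := by
    have := valuation_taylor_coeff_rootsInOpen (A := A) hΛ0 (IsAlgClosed.splits Λ) s₀ one_ne_zero
    rw [map_one, one_pow, mul_one, gaussValAt_one_eq_gaussVal A Λ hs₀A, hgΛ] at this
    rwa [hm]
  -- a radius `γ_top ∈ [v c₁, 1)` above all roots of `Λ` in the class
  set T := (Λ.roots.toFinset.filter fun τ => A.valuation (τ - s₀) < 1) with hT
  obtain ⟨ctop, hctop0, hctopγ₁, hctop1, hctopΛ⟩ : ∃ e : K, e ≠ 0 ∧ A.valuation c₁ ≤ A.valuation e ∧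
      A.valuation e < 1 ∧ ∀ τ ∈ Λ.roots, A.valuation (τ - s₀) < 1 → A.valuation (τ - s₀) ≤ A.valuation e := by
    by_cases hTe : T.Nonempty
    · obtain ⟨τ₁, hτ₁, hτ₁max⟩ := Finset.exists_max_image T (fun τ => A.valuation (τ - s₀)) hTe
      rw [Finset.mem_filter, Multiset.mem_toFinset] at hτ₁
      by_cases hcmp : A.valuation c₁ ≤ A.valuation (τ₁ - s₀)
      · refine ⟨τ₁ - s₀, ?_, hcmp, hτ₁.2, fun τ hτ hlt =>
          hτ₁max τ (Finset.mem_filter.mpr ⟨Multiset.mem_toFinset.mpr hτ, hlt⟩)⟩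
        intro h0; rw [h0, map_zero] at hcmp; exact (not_lt.mpr hcmp) hγ₁0
      · refine ⟨c₁, hc₁0, le_rfl, hγ₁1, fun τ hτ hlt => ?_⟩
        exact (hτ₁max τ (Finset.mem_filter.mpr ⟨Multiset.mem_toFinset.mpr hτ, hlt⟩)).trans
          (not_le.mp hcmp).le
    · refine ⟨c₁, hc₁0, le_rfl, hγ₁1, fun τ hτ hlt => ?_⟩
      exact absurd ⟨τ, Finset.mem_filter.mpr ⟨Multiset.mem_toFinset.mpr hτ, hlt⟩⟩ hTe
  have hrΛ : rootsIn A Λ s₀ (A.valuation ctop) = m := by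
    rw [hm, rootsIn, rootsInOpen]
    congr 1
    refine Multiset.filter_congr fun τ hτ => ⟨fun hle => lt_of_le_of_lt hle hctop1, fun hlt => ?_⟩
    exact hctopΛ τ hτ hlt
  have hvtop : 0 < A.valuation ctop := zero_lt_iff.mpr ((Valuation.ne_zero_iff _).mpr hctop0)
  -- optimality of `aₛ` at `γ_top`: `|P'|_top ≤ |Λ|_top < v b |q|_top`
  set Ltop : K[X] := C s₀ + C ctop * X with hLtop
  have hpairtop := h.comp s₀ hctop0
  have hcentretop : centre A (p.comp Ltop) (q.comp Ltop) = aₛ := by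
    rw [hLtop, centre_comp A p q s₀ hctop0, hrq hctop0 hctopγ₁ hctop1]
  have hopt := (hpairtop.optimal_centre A rfl rfl).1 lam
  rw [← centre, hcentretop, ← sub_C_mul_comp, ← sub_C_mul_comp, ← hP', ← hΛ] at hopt
  have hGqtop : gaussVal A (q.comp Ltop) = A.valuation ((taylor s₀ q).coeff μ) * A.valuation ctop ^ μ := by
    rw [hLtop, gaussVal_comp, ← hrq hctop0 hctopγ₁ hctop1]
    exact (valuation_taylor_coeff_rootsIn hq0 (IsAlgClosed.splits q) s₀ hctop0).symm
  have hGΛtop : gaussVal A (Λ.comp Ltop) = A.valuation ((taylor s₀ Λ).coeff m) * A.valuation ctop ^ m := by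
    rw [hLtop, gaussVal_comp, ← hrΛ]
    exact (valuation_taylor_coeff_rootsIn hΛ0 (IsAlgClosed.splits Λ) s₀ hctop0).symm
  have hΛlt : gaussVal A (Λ.comp Ltop) < A.valuation b * gaussVal A (q.comp Ltop) := by
    rw [hGΛtop, hGqtop, hΛm1, ← hQμ1, mul_assoc]
    refine mul_lt_mul_of_pos_left ?_ (zero_lt_iff.mpr ((Valuation.ne_zero_iff _).mpr hb0))
    refine mul_lt_mul_of_pos_left (pow_lt_pow_right_of_lt_one₀ hvtop hctop1 (by omega)) ?_
    rw [hQμ1]; exact hgq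
  -- hence `v(aₛ - λ) < v b`
  have haₛlam : A.valuation (aₛ - lam) < A.valuation b := by
    have hqtop0 : 0 < gaussVal A (q.comp Ltop) :=
      zero_lt_iff.mpr (gaussVal_ne_zero A (comp_C_add_C_mul_X_ne_zero hq0 s₀ hctop0))
    have e : C (aₛ - lam) * q.comp Ltop = Λ.comp Ltop - P'.comp Ltop := by
      rw [hΛ, hP', sub_C_mul_comp, sub_C_mul_comp, map_sub]; ring
    have : A.valuation (aₛ - lam) * gaussVal A (q.comp Ltop) < A.valuation b * gaussVal A (q.comp Ltop) := by
      rw [← gaussVal_C_mul, e]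
      exact lt_of_le_of_lt ((gaussVal_sub_le A _ _).trans (max_le le_rfl hopt)) hΛlt
    exact lt_of_mul_lt_mul_right' this
  -- perturbation at the unit disc: `P'` and `Λ` have the same reduction and Gauss value
  have hpert : gaussVal A (C (lam - aₛ) * q) < gaussVal A Λ := by
    rw [gaussVal_C_mul, hgΛ, ← Valuation.map_neg, neg_sub]
    exact mul_lt_mul_of_pos_right haₛlam hgq
  have hP'Λ : P' = Λ + C (lam - aₛ) * q := by rw [hP', hΛ, map_sub]; ring
  have hmP' : rootsInOpen A P' s₀ 1 = m := by
    rw [← count_redRoots_eq_rootsInOpen_one A P' hs₀A, hP'Λ,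
      redRoots_add_of_gaussVal_lt (IsAlgClosed.splits _) (IsAlgClosed.splits _) hpert,
      count_redRoots_eq_rootsInOpen_one A Λ hs₀A]
  have hgP' : gaussVal A P' = A.valuation b * gaussVal A q := by
    rw [hP'Λ, gaussVal_add_of_gaussVal_lt hpert, hgΛ]
  have hθ : A.valuation ((taylor s₀ P').coeff m) ≤ A.valuation b * A.valuation ((taylor s₀ q).coeff μ) := by
    have := valuation_taylor_coeff_rootsInOpen (A := A) hP'0 (IsAlgClosed.splits P') s₀ one_ne_zero
    rw [map_one, one_pow, mul_one, gaussValAt_one_eq_gaussVal A P' hs₀A, hgP', hmP'] at this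
    rw [this, hQμ1]
  have hrYₛ : rY A aₛ = rY A a := by
    apply rY_eq_of_valuation_sub_lt
    have : aₛ - a = (aₛ - lam) + (lam - a) := by ring
    rw [this]
    exact lt_of_le_of_lt (A.valuation.map_add _ _) (max_lt (lt_trans haₛlam hbY) (lt_of_le_of_lt hlama hbY))
  have hθY : A.valuation b < rY A aₛ := by rw [hrYₛ]; exact hbY
  -- the edge invariant at the bottom radius `v c₁`
  obtain ⟨hm₁, hcoeff₁⟩ := h.edge_invariant A htame hspec hμ hμ0 haₛ (m := m) hmP'.symm hμm hθ hθY
    hc₁0 le_rfl hγ₁1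
  set m₁ := rootsIn A P' s₀ (A.valuation c₁) with hm₁def
  -- the new pair
  set L₁ : K[X] := C s₀ + C c₁ * X with hL₁
  have hcentre₁ : centre A (p.comp L₁) (q.comp L₁) = aₛ := by
    rw [hL₁, centre_comp A p q s₀ hc₁0, hrq hc₁0 le_rfl hγ₁1]
  have hP'L₁ : p.comp L₁ - C aₛ * q.comp L₁ = P'.comp L₁ := (sub_C_mul_comp p q aₛ L₁).symm
  have hGq₁ : gaussVal A (q.comp L₁) = A.valuation ((taylor s₀ q).coeff μ) * A.valuation c₁ ^ μ := by
    rw [hL₁, gaussVal_comp, ← hrq hc₁0 le_rfl hγ₁1]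
    exact (valuation_taylor_coeff_rootsIn hq0 (IsAlgClosed.splits q) s₀ hc₁0).symm
  have hGP'₁ : gaussVal A (P'.comp L₁) = A.valuation ((taylor s₀ P').coeff m₁) * A.valuation c₁ ^ m₁ := by
    rw [hL₁, gaussVal_comp, hm₁def]
    exact (valuation_taylor_coeff_rootsIn hP'0 (IsAlgClosed.splits P') s₀ hc₁0).symm
  have hQμ0 : 0 < A.valuation ((taylor s₀ q).coeff μ) := by rw [hQμ1]; exact hgq
  have hdeep₁ : gaussVal A (P'.comp L₁) < rY A aₛ * gaussVal A (q.comp L₁) := by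
    rw [hGP'₁, hGq₁]
    have hle1 : A.valuation c₁ ^ m₁ ≤ A.valuation c₁ ^ μ := pow_le_pow_right_of_le_one' hγ₁1.le (by omega)
    have hpos : 0 < A.valuation ((taylor s₀ q).coeff μ) * A.valuation c₁ ^ μ := mul_pos hQμ0 (pow_pos hγ₁0 μ)
    calc A.valuation ((taylor s₀ P').coeff m₁) * A.valuation c₁ ^ m₁
        ≤ A.valuation b * A.valuation ((taylor s₀ q).coeff μ) * A.valuation c₁ ^ m₁ :=
          mul_le_mul' hcoeff₁ le_rfl
      _ ≤ A.valuation b * A.valuation ((taylor s₀ q).coeff μ) * A.valuation c₁ ^ μ := mul_le_mul' le_rfl hle1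
      _ = A.valuation b * (A.valuation ((taylor s₀ q).coeff μ) * A.valuation c₁ ^ μ) := by rw [mul_assoc]
      _ < rY A aₛ * (A.valuation ((taylor s₀ q).coeff μ) * A.valuation c₁ ^ μ) :=
          mul_lt_mul_of_pos_right hθY hpos
  refine ⟨s₀, c₁, hs₀F, ⟨hs₀A, hres₀⟩, hc₁0, hγ₁1, ?_, hspec, ⟨aₛ, by rw [hP'L₁]; exact hdeep₁⟩, ?_⟩
  · rw [hc₁, add_sub_cancel]; exact hs₁F
  · rw [hcentre₁, hP'L₁, hL₁, card_intRoots_comp_eq_rootsIn q s₀ hc₁0, hrq hc₁0 le_rfl hγ₁1,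
      card_intRoots_comp_eq_rootsIn P' s₀ hc₁0]
    exact hm₁

end Descend

end Literature.NumberTheory.DiophantineGeometry

end
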